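import Literature.AlgebraicGeometry.HodgeTheory.RealStructureSingular
import Literature.AlgebraicGeometry.Motives.PeriodRealizationClassical
import Mathlib.Algebra.Algebra.Hom.Rat
import HarnessLib

/-!
# Twisting `Hᵏ(Y; R)` by a ring homomorphism of the coefficients: semilinearity, cup products, rational classes

Family `hodge`, layer `Literature/AlgebraicGeometry/HodgeTheory`; theorems only (no definition, no
named fact, D-0026). Sequel of `RealStructureSingular` (`coeffClass g k : Hᵏ(Y; A) →+ Hᵏ(Y; B)`,
change of coefficients along an additive map `g`, with `coeffClass_π`, `coeffClass_map`,
`coeffClass_comp`, `coeffClass_id`, `smul_coeffClass`, `coeffClass_smul`) for the case of a RING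
homomorphism `τ : R →+* S` acting on `R`-valued classes (Hatcher, *Algebraic Topology*, §3.1 p. 198:
"a homomorphism of coefficient groups induces a cochain map"; §3.2 Prop. 3.10: naturality of `⌣`):

* `coeffClass_ringHom_smul` — `τ_*` is `τ`-SEMILINEAR: `τ_* (r • c) = τ r • τ_* c`;
* `coeffClass_ringHom_cupProduct` — `τ_*` is MULTIPLICATIVE: `τ_* (a ⌣ b) = τ_* a ⌣ τ_* b` (on
  cochains `τ (φ(σ|front) · ψ(σ|back)) = τ φ(σ|front) · τ ψ(σ|back)`), and `τ_* 1 = 1`;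
* `coeffClass_ringEquiv_symm_apply`, `coeffClass_ringEquiv_apply_symm`,
  `coeffClass_ringEquiv_bijective` — for a ring AUTOMORPHISM `σ`, `σ_*` is bijective with inverse
  `(σ⁻¹)_*`;
* over `ℂ`: `coeffClass_ringHom_ofRatClass` (`τ_* (a ⊗ 1) = a ⊗ 1`: every ring endomorphism of `ℂ`
  fixes `ℚ`), `IsRationalClass.coeffClass_ringHom_eq` (rational classes are fixed),
  `coeffClass_ringHom_ofRatClassBaseChange` (`τ_* ∘ β = β ∘ (τ ⊗ 1)` for the complexification
  `β : ℂ ⊗_ℚ Hᵏ(Y; ℚ) → Hᵏ(Y; ℂ)` of `Motives/PeriodRealizationClassical`),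
  `coeffClass_ringHom_mem_span_of_isRationalClass` (the `ℂ`-span of rational classes is stable).

These are the "transport of structure by `σ ∈ Aut(ℂ)`" identities used to twist the Hodge
decomposition of `Hᵏ(X(ℂ); ℂ) = Hᵏ(X(ℂ); ℚ) ⊗ ℂ` by field automorphisms of `ℂ` (Deligne, *Hodge
cycles on abelian varieties*, LNM 900, I §3, proof of Prop. 3.4: the Mumford–Tate group is generated by
the conjugates `σμ`, `σ ∈ Aut(ℂ)`, of the Hodge cocharacter) — file
`Deligne1982/HodgeGroupGaloisTwistedHodgeOperators`.

## References

* [HatcherAT2002] A. Hatcher, *Algebraic Topology* (2002), §3.1 p. 198 (change of coefficients),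
  §3.2 p. 206 and Prop. 3.10 (cup product and naturality).
* [Deligne1982HodgeCycles] P. Deligne, *Hodge cycles on abelian varieties*, LNM 900 (1982), I §3,
  proof of Prop. 3.4.
-/

noncomputable section

open CategoryTheory
open scoped TensorProduct

universe u v

namespace Literature.AlgebraicGeometry.HodgeTheory

section HodgeTheory

-- the cochain modules of `singularCochainComplex` are function types up to unfolding
set_option backward.isDefEq.respectTransparency false

open Literature.AlgebraicTopology.SingularHomology singularCochainComplex

variable {Y : Type u} [TopologicalSpace Y]

/-! ### Ring homomorphisms of coefficients: semilinearity and multiplicativity -/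

section RingHom

variable {R S : Type v} [CommRing R] [CommRing S] (τ : R →+* S)

/-- **`τ_*` is `τ`-semilinear**: `τ_* (r • c) = τ r • τ_* c` for a ring homomorphism of coefficients
`τ : R →+* S` (on cochains, `τ (r · φ(σ)) = τ r · τ (φ σ)`). [cite: HatcherAT2002, §3.1 p. 198] -/
theorem coeffClass_ringHom_smul (r : R) {k : ℕ} (c : singularCohomology R R Y k) :
    coeffClass (R := R) (S := S) τ.toAddMonoidHom k (r • c) =
      τ r • coeffClass (R := R) (S := S) τ.toAddMonoidHom k c := by
  rw [coeffClass_smul, smul_coeffClass]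
  exact coeffClass_congr (fun a ↦ by simp [smul_eq_mul, map_mul]) c

/-- **`τ_*` is multiplicative for the cup product**: `τ_* (a ⌣ b) = τ_* a ⌣ τ_* b` — on cochains the
Alexander–Whitney formula `(φ ⌣ ψ)(σ) = φ(σ|[v₀…vₚ]) · ψ(σ|[vₚ…vₙ])` is multiplicative in the values
and `τ` is a ring homomorphism. [cite: HatcherAT2002, §3.2 p. 206 and Prop. 3.10] -/
theorem coeffClass_ringHom_cupProduct {p q n : ℕ} (h : p + q = n) (a : singularCohomology R R Y p)
    (b : singularCohomology R R Y q) :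
    coeffClass (R := R) (S := S) τ.toAddMonoidHom n (cupProduct h a b) =
      cupProduct h (coeffClass (R := R) (S := S) τ.toAddMonoidHom p a)
        (coeffClass (R := R) (S := S) τ.toAddMonoidHom q b) := by
  induction a using singularCohomology_induction_on with
  | h za =>
    induction b using singularCohomology_induction_on with
    | h zb =>
      rw [cupProduct_π_π, coeffClass_π, coeffClass_π, coeffClass_π, cupProduct_π_π]
      exact congrArg _ (cocycles_ext (by
        rw [iCocycles_coeffCocycle, iCocycles_cocyclesCup, iCocycles_cocyclesCup,
          iCocycles_coeffCocycle, iCocycles_coeffCocycle]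
        exact singularCochainComplex.ext fun σ ↦ by
          rw [coeffCochain_apply, cochainCup_apply, cochainCup_apply, coeffCochain_apply,
            coeffCochain_apply]
          exact map_mul τ _ _))

/-- `τ_* 1 = 1` for the unit class `1 ∈ H⁰(Y; R)` (on cochains `τ 1 = 1`). [cite: HatcherAT2002, §3.2 p. 211] -/
theorem coeffClass_ringHom_one :
    coeffClass (R := R) (S := S) τ.toAddMonoidHom 0 (singularCohomology.one R Y) =
      singularCohomology.one S Y := by
  rw [singularCohomology.one, singularCohomology.one, coeffClass_π]
  exact congrArg _ (cocycles_ext (by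
    rw [iCocycles_coeffCocycle, iCocycles_mk, iCocycles_mk]
    exact singularCochainComplex.ext fun σ ↦ by
      rw [coeffCochain_apply, cochainOne_apply, cochainOne_apply]
      exact map_one τ))

end RingHom

/-! ### Ring automorphisms of coefficients: `σ_*` is bijective -/

section RingEquiv

variable {R : Type v} [CommRing R] (σ : R ≃+* R)

/-- `(σ⁻¹)_* (σ_* c) = c` for a ring automorphism `σ` of the coefficients (functoriality
`coeffClass_comp`). [cite: HatcherAT2002, §3.1 p. 198] -/
@[simp]
theorem coeffClass_ringEquiv_symm_apply {k : ℕ} (c : singularCohomology R R Y k) :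
    coeffClass (R := R) (S := R) σ.symm.toRingHom.toAddMonoidHom k
        (coeffClass (R := R) (S := R) σ.toRingHom.toAddMonoidHom k c) = c := by
  rw [← coeffClass_comp]
  rw [coeffClass_congr (g' := AddMonoidHom.id R) (fun a ↦ by simp) c, coeffClass_id]

/-- `σ_* ((σ⁻¹)_* c) = c` for a ring automorphism `σ` of the coefficients. [cite: HatcherAT2002, §3.1 p. 198] -/
@[simp]
theorem coeffClass_ringEquiv_apply_symm {k : ℕ} (c : singularCohomology R R Y k) :
    coeffClass (R := R) (S := R) σ.toRingHom.toAddMonoidHom k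
        (coeffClass (R := R) (S := R) σ.symm.toRingHom.toAddMonoidHom k c) = c := by
  simpa using coeffClass_ringEquiv_symm_apply (Y := Y) σ.symm c

/-- **`σ_*` is bijective on `Hᵏ(Y; R)`** for a ring automorphism `σ` of `R`, with inverse `(σ⁻¹)_*`.
[cite: HatcherAT2002, §3.1 p. 198] -/
theorem coeffClass_ringEquiv_bijective (k : ℕ) :
    Function.Bijective (coeffClass (R := R) (S := R) (Y := Y) σ.toRingHom.toAddMonoidHom k) :=
  Function.bijective_iff_has_inverse.2 ⟨coeffClass (R := R) (S := R) σ.symm.toRingHom.toAddMonoidHom k,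
    coeffClass_ringEquiv_symm_apply σ, coeffClass_ringEquiv_apply_symm σ⟩

/-- `σ_*` is injective. [cite: HatcherAT2002, §3.1 p. 198] -/
theorem coeffClass_ringEquiv_injective (k : ℕ) :
    Function.Injective (coeffClass (R := R) (S := R) (Y := Y) σ.toRingHom.toAddMonoidHom k) :=
  (coeffClass_ringEquiv_bijective σ k).1

end RingEquiv

/-! ### Over `ℂ`: rational classes are fixed by every ring endomorphism of `ℂ` -/

section Complex

variable (τ : ℂ →+* ℂ)

/-- **`τ_* (a ⊗ 1) = a ⊗ 1`**: a ring endomorphism `τ` of `ℂ` fixes the rational lattice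
`Hᵏ(Y; ℚ) ⊗ 1 ⊆ Hᵏ(Y; ℂ)` (`τ ∘ (ℚ ↪ ℂ) = (ℚ ↪ ℂ)`: ring homomorphisms fix `ℚ`).
[cite: HatcherAT2002, §3.1 p. 198] -/
@[simp]
theorem coeffClass_ringHom_ofRatClass {k : ℕ} (a : singularCohomology ℚ ℚ Y k) :
    coeffClass (R := ℂ) (S := ℂ) τ.toAddMonoidHom k (ofRatClass Y k a) = ofRatClass Y k a := by
  rw [ofRatClass, ← coeffClass_comp]
  exact coeffClass_congr (fun q ↦ by simp) a

/-- **Rational classes are fixed by every ring endomorphism of `ℂ`**: `τ_* c = c` for `c` rational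
(`c = a ⊗ 1`, `isRationalClass_iff_mem_range_ofRatClass`). [cite: HatcherAT2002, §3.1 p. 198] -/
theorem IsRationalClass.coeffClass_ringHom_eq {k : ℕ} {c : singularCohomology ℂ ℂ Y k}
    (hc : IsRationalClass c) : coeffClass (R := ℂ) (S := ℂ) τ.toAddMonoidHom k c = c := by
  obtain ⟨a, rfl⟩ := (isRationalClass_iff_mem_range_ofRatClass c).1 hc
  exact coeffClass_ringHom_ofRatClass τ a

/-- The `ℂ`-span of a family of rational classes is stable under `τ_*`:
`τ_* (Σ cᵢ • bᵢ) = Σ τ(cᵢ) • bᵢ`. [cite: HatcherAT2002, §3.1 p. 198] -/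
theorem coeffClass_ringHom_mem_span_of_isRationalClass {k : ℕ} {ι : Type*}
    {b : ι → singularCohomology ℂ ℂ Y k} (hb : ∀ i, IsRationalClass (b i))
    {c : singularCohomology ℂ ℂ Y k} (hc : c ∈ Submodule.span ℂ (Set.range b)) :
    coeffClass (R := ℂ) (S := ℂ) τ.toAddMonoidHom k c ∈ Submodule.span ℂ (Set.range b) := by
  induction hc using Submodule.span_induction with
  | mem x hx =>
    obtain ⟨i, rfl⟩ := hx
    rw [(hb i).coeffClass_ringHom_eq τ]
    exact Submodule.subset_span ⟨i, rfl⟩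
  | zero => rw [map_zero]; exact Submodule.zero_mem _
  | add x y _ _ hx hy => rw [map_add]; exact Submodule.add_mem _ hx hy
  | smul a x _ hx => rw [coeffClass_ringHom_smul]; exact Submodule.smul_mem _ _ hx

/-- **`τ_*` is the complexification of the identity twisted by `τ`**: on the complexification
`β : ℂ ⊗_ℚ Hᵏ(Y; ℚ) → Hᵏ(Y; ℂ)`, `β (c ⊗ a) = c • (a ⊗ 1)` (`Motives.ofRatClassBaseChange`), one has
`τ_* (β t) = β ((τ ⊗ 1) t)`, where `τ ⊗ 1` is `τ` (a `ℚ`-algebra map) tensored with the identity.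
[cite: HatcherAT2002, §3.1 p. 198] -/
theorem coeffClass_ringHom_ofRatClassBaseChange {k : ℕ} (t : ℂ ⊗[ℚ] singularCohomology ℚ ℚ Y k) :
    coeffClass (R := ℂ) (S := ℂ) τ.toAddMonoidHom k (Motives.ofRatClassBaseChange Y k t) =
      Motives.ofRatClassBaseChange Y k ((τ.toRatAlgHom.toLinearMap.rTensor _) t) := by
  induction t using TensorProduct.induction_on with
  | zero => rw [map_zero, map_zero, map_zero, map_zero]
  | tmul c a =>
    rw [LinearMap.rTensor_tmul, Motives.ofRatClassBaseChange_tmul, Motives.ofRatClassBaseChange_tmul,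
      coeffClass_ringHom_smul, coeffClass_ringHom_ofRatClass]
    rfl
  | add s t hs ht => rw [map_add, map_add, hs, ht, map_add, map_add]

end Complex

end HodgeTheory

end Literature.AlgebraicGeometry.HodgeTheory

end
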